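import Literature.NumberTheory.EllipticCurves.RingClassFieldClassNumber
import Literature.NumberTheory.EllipticCurves.RingClassFieldGenus
import Literature.NumberTheory.EllipticCurves.RingClassFieldGenusDatum
import Literature.NumberTheory.NumberFields.BauerSplitPrimes
import Literature.NumberTheory.NumberFields.QuadraticExtensionDegreeOneSplitting
import Literature.NumberTheory.QuadraticFields.RingClassGenusCharacterTriviality
import Mathlib.FieldTheory.KummerPolynomial
import Mathlib.NumberTheory.NumberField.Discriminant.Different
import HarnessLib

/-!
# Genus theory of ring class fields, PROVED: `√d ∈ K[f]` for `d ≡ 1 (mod 4)`, `|d| ∣ f`, and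
# `√d ∉ K[m]` for a prime `ℓ ∥ d` with `ℓ ∤ m·d_K` (Cox, *Primes of the form x² + ny²*, §9.A,
# Thm. 6.1; Cohn 1985, Thm. 2.2.23) — discharge of the named facts
# `RingClassField.genusRadical_mem_and_not_mem` and `Cox2013_sqrt_pStar_mem_ringClassField`

Topic `NumberTheory/EllipticCurves` (class field theory of the ring class fields
`K[f] = ringClassField K ι f ⊂ ℂ` of `HeegnerPointsOfConductor.lean`). Theorems only (no definition,
no named fact); everything below is PROVED from the tree's (proved) class field theory of `K[f]`:

* `le_of_splitPrimes_subset_of_prime_absNorm_algClosure` — Bauer's theorem inside `K̄` with the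
  hypothesis restricted to primes of degree one (the tree's `le_of_splitPrimes_subset_of_prime_absNorm`,
  Neukirch VII (13.9), run in a compositum; cf. `le_of_splitPrimes_subset_algClosure`);
* `exists_quadratic_intermediateField_of_not_isSquare` (private helper) — `K(√d) ⊂ K̄` as a finite
  Galois quadratic subextension, for `d` not a square in `K`;
* **`sqrt_intCast_mem_ringClassField`** — **`√d ∈ K[f]`** for `K` imaginary quadratic, `d ≡ 1 (mod 4)`
  and `f ≥ 1` with `|d| ∣ f` (no square-freeness needed). PROOF (Cox §9.A with Thm. 6.1 / genus
  theory): `K[f]` is the class field `R_f` of `P_{K,ℤ}(f)` (`exists_classField_algEquiv_ringClassField`,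
  Cox Thm. 11.1); a degree-one prime `𝔭 ∤ 2f` of `K` splitting completely in `R_f` has `[𝔭] = 1`,
  so `𝔭 = (a)`, `a ≡ n (mod f)`, `N𝔭 = ℓ ≡ n² (mod |d|)` and `(d/ℓ) = 1`
  (`RingClass.isSquare_intCast_zmod_absNorm_of_primeClass_eq_one`); hence `𝔭` splits in `K(√d)`
  (`QuadraticExtension.mem_splitPrimes_of_isSquare_zmod`, Hensel); by Bauer (degree-one form)
  `K(√d) ⊆ R_f ≅ K[f]`;
* **`sqrt_intCast_not_mem_ringClassField`** — **`√d ∉ K[m]`** for a prime `ℓ` with `ℓ ∥ d`,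
  `ℓ ∤ m`, `ℓ ∤ d_K`: a prime `w` of `K[m]` above `ℓ` has `e(w|ℓ) = e(w|v) e(v|ℓ) = 1`
  (`isUnramifiedIn_ringClassField`, Cox §9.A "all primes of `K` ramified in `L` divide `f𝒪_K`",
  and Dedekind's discriminant theorem, Mathlib `NumberField.not_dvd_discr_iff_forall_mem`), so
  `ord_w(d) = 1` is odd and `d` is not a square in `K[m]_w ⊇ K[m]`
  (`not_isSquare_adicCompletion_intCast_of_dvd_of_not_sq_dvd`);
* **`RingClassField.genusRadical_mem_and_not_mem_holds`** — the named fact of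
  `RingClassFieldGenus.lean` (Cohn 1985 Thm. 2.2.23 / Cox §9.A; cell `bsd-uniform`, consumed by
  `Summit.BirchSwinnertonDyer.Uniform.U2.bsdp_two_of_genusTheory`) is now a THEOREM;
* **`Cox2013_sqrt_pStar_mem_ringClassField_holds`** — the named fact of `RingClassFieldGenusDatum.lean`
  (`√p* ∈ K[p]`, work item `wi-73261`) is now a THEOREM (the hypothesis `p ∤ d_K` is not needed).

HONEST FRAMING: classical, published class field theory (genus theory of orders), proved here on top
of the tree's proved Artin reciprocity / Bauer / Cox Thm. 11.1 files; no statement about elliptic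
curves, `L`-functions or BSD is made; for the cell `bsd-uniform` this removes one NAMED FACT from
the trust base of the booked U2 head, nothing else changes.

## References

* D. A. Cox, *Primes of the form x² + ny²*, 2nd ed. (2013): §6.A Thm. 6.1, §7.C Lemma 7.18,
  §9.A (p. 180: ramification; Thm. 9.2), Thm. 9.18, §11.A Thm. 11.1. [Cox2013]
* H. Cohn, *Introduction to the Construction of Class Fields* (1985), (2.2.22)–Thm. 2.2.23,
  Thm. 8.2.15. [Cohn1985]
* J. Neukirch, *Algebraic Number Theory* (1999), Ch. VII (13.9); Ch. III (2.12). [NeukirchANT1999]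
-/

noncomputable section

open NumberField IsDedekindDomain IsDedekindDomain.HeightOneSpectrum Filter Polynomial
open scoped nonZeroDivisors IntermediateField

namespace Literature.NumberTheory.EllipticCurves

open Literature.NumberTheory.GaloisRepresentations Literature.NumberTheory.NumberFields
open Literature.NumberTheory.NumberFields.RingClassField
open Literature.NumberTheory.QuadraticFields.RingClass

variable {K : Type} [Field K] [NumberField K]

/-! ### Bauer's theorem inside `K̄`, degree-one form -/

/-- **Bauer's theorem inside `K̄` with degree-one primes** (Neukirch VII (13.9)–(13.10): a finite
Galois extension is determined by its completely split primes, the primes of degree `> 1` having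
density zero): for finite Galois `E₁, E₂ ⊆ K̄` over `K`, if all but finitely many primes `v` of `K`
OF PRIME ABSOLUTE NORM that split completely in `E₁` split completely in `E₂`, then `E₂ ⊆ E₁`
(the tree's `le_of_splitPrimes_subset_of_prime_absNorm`, run in the compositum `E₁E₂ ⊆ K̄`).
[cite: NeukirchANT1999, Ch. VII Prop. (13.9) and Cor. (13.10)] -/
theorem le_of_splitPrimes_subset_of_prime_absNorm_algClosure
    {E₁ E₂ : IntermediateField K (AlgebraicClosure K)}
    [FiniteDimensional K E₁] [IsGalois K E₁] [FiniteDimensional K E₂] [IsGalois K E₂]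
    (h : ∀ᶠ v : HeightOneSpectrum (𝓞 K) in cofinite, (Ideal.absNorm v.asIdeal).Prime →
      v ∈ splitPrimes K E₁ → v ∈ splitPrimes K E₂) :
    E₂ ≤ E₁ := by
  classical
  haveI : NumberField E₁ := NumberField.of_module_finite K E₁
  haveI : NumberField E₂ := NumberField.of_module_finite K E₂
  set L₀ : IntermediateField K (AlgebraicClosure K) := E₁ ⊔ E₂ with hL₀def
  haveI : FiniteDimensional K L₀ := IntermediateField.finiteDimensional_sup E₁ E₂
  haveI : Normal K L₀ := inferInstance
  haveI : IsGalois K L₀ := IsGalois.mk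
  haveI : NumberField L₀ := NumberField.of_module_finite K L₀
  set F₁ : IntermediateField K L₀ := IntermediateField.restrict (le_sup_left : E₁ ≤ L₀) with hF₁
  set F₂ : IntermediateField K L₀ := IntermediateField.restrict (le_sup_right : E₂ ≤ L₀) with hF₂
  haveI : IsGalois K F₁ := IsGalois.of_algEquiv (IntermediateField.restrict_algEquiv _)
  haveI : IsGalois K F₂ := IsGalois.of_algEquiv (IntermediateField.restrict_algEquiv _)
  haveI : NumberField F₁ := NumberField.of_module_finite K F₁
  haveI : NumberField F₂ := NumberField.of_module_finite K F₂
  have hF : F₂ ≤ F₁ := by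
    refine le_of_splitPrimes_subset_of_prime_absNorm F₁ F₂ (h.mono fun v hv hprime => ?_)
    rw [← splitPrimes_eq_of_algEquiv (IntermediateField.restrict_algEquiv (le_sup_left : E₁ ≤ L₀)),
      ← splitPrimes_eq_of_algEquiv (IntermediateField.restrict_algEquiv (le_sup_right : E₂ ≤ L₀))]
    exact hv hprime
  intro x hx
  have hxL : x ∈ L₀ := (le_sup_right : E₂ ≤ L₀) hx
  have hx₂ : (⟨x, hxL⟩ : L₀) ∈ F₂ := (IntermediateField.mem_restrict _ _).mpr hx
  exact (IntermediateField.mem_restrict _ _).mp (hF hx₂)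

/-! ### The quadratic subextension `K(√d) ⊆ K̄` -/

omit [NumberField K] in
/-- **`K(√d) ⊆ K̄` is a quadratic Galois extension** when `d` is not a square in `K`: for a root
`s ∈ K̄` of `X² − d`, the field `Q = K(s)` has `[Q : K] = 2` (`X² − d` is irreducible, Mathlib
`X_pow_sub_C_irreducible_of_prime`), is Galois over `K`, and `s ∉ K`. [folklore] -/
private theorem exists_quadratic_intermediateField_of_not_isSquare [CharZero K] {d : K}
    (hd : ¬ IsSquare d) :
    ∃ (Q : IntermediateField K (AlgebraicClosure K)) (s : Q), FiniteDimensional K Q ∧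
      Algebra.IsQuadraticExtension K Q ∧ IsGalois K Q ∧
      s ^ 2 = algebraMap K Q d ∧ ∀ r : K, algebraMap K Q r ≠ s := by
  obtain ⟨s₀, hs₀⟩ := IsAlgClosed.exists_pow_nat_eq (algebraMap K (AlgebraicClosure K) d) two_pos
  have hirr : Irreducible (X ^ 2 - C d : K[X]) := by
    refine X_pow_sub_C_irreducible_of_prime Nat.prime_two fun b hb => hd ⟨b, ?_⟩
    rw [← hb]; ring
  have hint : IsIntegral K s₀ := Algebra.IsIntegral.isIntegral s₀
  have hmin : minpoly K s₀ = X ^ 2 - C d := by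
    refine (minpoly.eq_of_irreducible_of_monic hirr ?_ (monic_X_pow_sub_C d two_ne_zero)).symm
    simp [hs₀]
  set Q : IntermediateField K (AlgebraicClosure K) := K⟮s₀⟯ with hQ
  have h2 : Module.finrank K Q = 2 := by
    rw [hQ, IntermediateField.adjoin.finrank hint, hmin, natDegree_X_pow_sub_C]
  haveI hfd : FiniteDimensional K Q := Module.finite_of_finrank_eq_succ h2
  haveI hquad : Algebra.IsQuadraticExtension K Q := { finrank_eq_two' := h2 }
  haveI : IsGalois K Q := inferInstance
  refine ⟨Q, ⟨s₀, IntermediateField.mem_adjoin_simple_self K s₀⟩, hfd, hquad, inferInstance, ?_, ?_⟩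
  · apply Subtype.ext
    rw [SubmonoidClass.mk_pow, IntermediateField.coe_algebraMap_apply]
    exact hs₀
  · intro r hr
    apply hd
    refine ⟨r, ?_⟩
    have h0 : algebraMap K (AlgebraicClosure K) r = s₀ := by
      have := congrArg (fun x : Q => (x : AlgebraicClosure K)) hr
      rwa [IntermediateField.coe_algebraMap_apply] at this
    have h2' : algebraMap K (AlgebraicClosure K) (r ^ 2) = algebraMap K (AlgebraicClosure K) d := by
      rw [map_pow, h0]; exact hs₀
    have := (algebraMap K (AlgebraicClosure K)).injective h2'
    rw [← this]; ring

/-! ### `√d ∈ K[f]` for `d ≡ 1 (mod 4)`, `|d| ∣ f` -/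

/-- **Genus theory of the ring class field: `√d ∈ K[f]`.** Let `K` be an imaginary quadratic
field, `ι : K → ℂ`, `d ≡ 1 (mod 4)` an integer and `f ≥ 1` with `|d| ∣ f`. Then every complex
square root of `d` lies in the ring class field `K[f] = ringClassField K ι f` (Cox §9.A with
Thm. 6.1: `K(√d)/K` is the class field of the subgroup of `I_K(f)/P_{K,ℤ}(f)` cut out by the genus
character `(d/N·)`, which kills `P_{K,ℤ}(f)` — `N(α) ≡ a² (mod f)` for `α ≡ a` — so
`K(√d) ⊆ K[f]`; Cohn 1985, (2.2.22)–Thm. 2.2.23: the genus field `ℚ(√q₁*,…,√q_t*)K` lies in the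
ring class field). Proof: Bauer's theorem (degree-one form) applied to `K(√d)` and the class field
`R_f ≅ K[f]` of `exists_classField_algEquiv_ringClassField`, the splitting being supplied by
`RingClass.isSquare_intCast_zmod_absNorm_of_primeClass_eq_one` and
`QuadraticExtension.mem_splitPrimes_of_isSquare_zmod`.
[cite: Cox2013, §9.A Thm. 9.2, §6.A Thm. 6.1, §11.A Thm. 11.1] [cite: Cohn1985, (2.2.22)–Thm. 2.2.23] -/
theorem sqrt_intCast_mem_ringClassField (hK : IsImaginaryQuadratic K) (ι : K →+* ℂ) {d : ℤ}
    (hd4 : d % 4 = 1) {f : ℕ} (hf : f ≠ 0) (hdf : d.natAbs ∣ f) (r : ℂ) (hr : r ^ 2 = (d : ℂ)) :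
    r ∈ ringClassField K ι f := by
  classical
  -- it suffices to find ONE square root of `d` in `K[f]`
  suffices hz : ∃ z : ℂ, z ∈ ringClassField K ι f ∧ z ^ 2 = (d : ℂ) by
    obtain ⟨z, hz, hz2⟩ := hz
    rcases sq_eq_sq_iff_eq_or_eq_neg.mp (hr.trans hz2.symm) with h | h
    · rw [h]; exact hz
    · rw [h]; exact neg_mem hz
  by_cases hsqK : IsSquare (d : K)
  · -- `d = k²` in `K`: `ι k ∈ K[f]`
    obtain ⟨k, hk⟩ := hsqK
    refine ⟨ι k, apply_mem_ringClassField ι f k, ?_⟩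
    rw [sq, ← map_mul, ← hk, map_intCast]
  -- the quadratic field `Q = K(√d) ⊆ K̄` and the class field `R ≅ K[f]`
  obtain ⟨Q, s, hfdQ, hquad, hgalQ, hs2, hsK⟩ :=
    exists_quadratic_intermediateField_of_not_isSquare (K := K) hsqK
  haveI := hfdQ
  haveI := hquad
  haveI := hgalQ
  haveI : NumberField Q := NumberField.of_module_finite K Q
  obtain ⟨R, hfd, hgal, -, hsplit, ⟨e⟩⟩ := exists_classField_algEquiv_ringClassField hK ι hf
  haveI := hfd
  haveI := hgal
  -- Bauer: `Q ≤ R`, testing on degree-one primes `v ∤ 2f` that split completely in `R`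
  have hQR : Q ≤ R := by
    refine le_of_splitPrimes_subset_of_prime_absNorm_algClosure ?_
    have h𝔪 : Ideal.span {((2 * f : ℕ) : 𝓞 K)} ≠ ⊥ := by
      rw [Ne, Ideal.span_singleton_eq_bot]; exact_mod_cast (mul_ne_zero two_ne_zero hf)
    have hev : ∀ᶠ v : HeightOneSpectrum (𝓞 K) in cofinite,
        ¬ Ideal.span {((2 * f : ℕ) : 𝓞 K)} ≤ v.asIdeal := by
      rw [Filter.eventually_cofinite]
      simpa using finite_setOf_le_asIdeal h𝔪
    refine hev.mono fun v hv hprime hvR => ?_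
    set ℓ : ℕ := Ideal.absNorm v.asIdeal with hℓdef
    have hℓv : ((ℓ : ℕ) : 𝓞 K) ∈ v.asIdeal := Ideal.absNorm_mem v.asIdeal
    -- `v ∤ f`, `v ∤ 2`, `ℓ ∤ d`
    have hmem_of_dvd : ∀ n : ℕ, n ∣ 2 * f → ((n : ℕ) : 𝓞 K) ∈ v.asIdeal →
        Ideal.span {((2 * f : ℕ) : 𝓞 K)} ≤ v.asIdeal := fun n hn hnv => by
      rw [Ideal.span_singleton_le_iff_mem]
      obtain ⟨k, hk⟩ := hn
      rw [hk, Nat.cast_mul]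
      exact Ideal.mul_mem_right _ _ hnv
    have hvf : ¬ Ideal.span {((f : ℕ) : 𝓞 K)} ≤ v.asIdeal := fun hle =>
      hv (hmem_of_dvd f (dvd_mul_left f 2) ((Ideal.span_singleton_le_iff_mem _).mp hle))
    have hℓ2 : ℓ ≠ 2 := fun h2 =>
      hv (hmem_of_dvd 2 (dvd_mul_right 2 f) (h2 ▸ hℓv))
    have hℓd : ¬ (ℓ : ℤ) ∣ d := fun hℓd => by
      have hℓf : ℓ ∣ f := (Int.natCast_dvd.mp hℓd).trans hdf
      exact hv (hmem_of_dvd ℓ (hℓf.trans (dvd_mul_left f 2)) hℓv)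
    -- `[𝔭_v] = 1`, so `d` is a square mod `ℓ = N v`, so `v` splits in `Q`
    have h1 : primeClass f v = 1 := (hsplit v hvf).mp hvR
    have hsq : IsSquare ((d : ZMod ℓ)) :=
      isSquare_intCast_zmod_absNorm_of_primeClass_eq_one hK.1 hK.discr_neg hd4 hdf hvf h1
        hprime hℓ2 rfl
    exact NumberFields.QuadraticExtension.mem_splitPrimes_of_isSquare_zmod hs2 hsK v hprime hℓ2
      rfl hℓd hsq
  -- transport `s ∈ Q ≤ R ≅ K[f] ⊂ ℂ`
  set sR : R := ⟨(s : AlgebraicClosure K), hQR s.2⟩ with hsR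
  have hsR2 : sR ^ 2 = algebraMap K R d := by
    apply Subtype.ext
    have h := congrArg (fun x : Q => (x : AlgebraicClosure K)) hs2
    rw [SubmonoidClass.coe_pow, IntermediateField.coe_algebraMap_apply] at h
    rw [SubmonoidClass.coe_pow, IntermediateField.coe_algebraMap_apply]
    exact h
  refine ⟨((e sR : ringClassField K ι f) : ℂ), (e sR).2, ?_⟩
  have h3 : (e sR) ^ 2 = algebraMap K (ringClassField K ι f) d := by
    rw [← map_pow, hsR2, AlgEquiv.commutes]
  have h4 := congrArg (fun x : ringClassField K ι f => (x : ℂ)) h3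
  simp only [SubmonoidClass.coe_pow, map_intCast] at h4
  rw [h4]
  simp

/-! ### `√d ∉ K[m]` at a prime `ℓ ∥ d` with `ℓ ∤ m d_K` -/

/-- **`√d ∉ K[m]` when a prime `ℓ` divides `d` exactly once and `ℓ ∤ m`, `ℓ ∤ d_K`.** For `K`
imaginary quadratic and `m ≥ 1`: a prime `w` of `K[m]` above `ℓ` is unramified over the prime
`v = w ∩ 𝓞_K` (Cox §9.A: "all primes of `K` ramified in [the ring class field of conductor `m`]
must divide `m𝒪_K`", the tree's `isUnramifiedIn_ringClassField`), and `v` is unramified over `ℓ`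
(`ℓ ∤ d_K`, Dedekind's discriminant theorem); so `e(w|ℓ) = 1`, `ord_w(d) = ord_ℓ(d) = 1` is odd,
and `d` is not a square in the completion `K[m]_w`, let alone in `K[m]`.
[cite: Cox2013, §9.A (p. 180) and Prop. 5.16] [cite: NeukirchANT1999, Ch. III Thm. (2.12)] -/
theorem sqrt_intCast_not_mem_ringClassField (hK : IsImaginaryQuadratic K) (ι : K →+* ℂ) {m ℓ : ℕ}
    (hm : m ≠ 0) (hℓ : ℓ.Prime) {d : ℤ} (hℓd : (ℓ : ℤ) ∣ d) (hℓ2d : ¬ (ℓ : ℤ) ^ 2 ∣ d)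
    (hℓm : ¬ ℓ ∣ m) (hℓD : ¬ (ℓ : ℤ) ∣ NumberField.discr K) (r : ℂ) (hr : r ^ 2 = (d : ℂ)) :
    r ∉ ringClassField K ι m := by
  classical
  intro hrL
  set L := ringClassField K ι m with hLdef
  haveI := (finiteDimensional_and_isGalois_ringClassField hK ι hm).1
  haveI : NumberField L := NumberField.of_module_finite K L
  -- a prime `w` of `L` above `ℓ`, and `v = w ∩ 𝓞 K`
  have hℓZ : Prime (ℓ : ℤ) := Nat.prime_iff_prime_int.mp hℓ
  haveI hmax : (Ideal.span {(ℓ : ℤ)}).IsMaximal :=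
    ((Ideal.span_singleton_prime hℓZ.ne_zero).mpr hℓZ).isMaximal
      (by rw [Ne, Ideal.span_singleton_eq_bot]; exact hℓZ.ne_zero)
  obtain ⟨W, hWmax, hWover⟩ :=
    Ideal.exists_maximal_ideal_liesOver_of_isIntegral (R := ℤ) (S := 𝓞 L) (Ideal.span {(ℓ : ℤ)})
  have hWbot : W ≠ ⊥ := Ring.ne_bot_of_isMaximal_of_not_isField hWmax (RingOfIntegers.not_isField L)
  set w : HeightOneSpectrum (𝓞 L) := ⟨W, hWmax.isPrime, hWbot⟩ with hwdef
  have hℓw : ((ℓ : ℕ) : 𝓞 L) ∈ w.asIdeal := by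
    have : algebraMap ℤ (𝓞 L) (ℓ : ℤ) ∈ W := by
      rw [← Ideal.mem_comap, ← Ideal.under_def, ← hWover.over]
      exact Ideal.mem_span_singleton_self _
    simpa using this
  set v : HeightOneSpectrum (𝓞 K) := w.under (𝓞 K) with hvdef
  haveI hwv : w.asIdeal.LiesOver v.asIdeal := ⟨rfl⟩
  have hℓv : ((ℓ : ℕ) : 𝓞 K) ∈ v.asIdeal := by
    change algebraMap (𝓞 K) (𝓞 L) ((ℓ : ℕ) : 𝓞 K) ∈ w.asIdeal
    rw [map_natCast]; exact hℓw
  -- `e(v | ℓ) = 1` since `ℓ ∤ d_K`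
  haveI hunrv : Algebra.IsUnramifiedAt ℤ v.asIdeal :=
    (NumberField.not_dvd_discr_iff_forall_mem K (𝓞 K) hℓZ).mp hℓD v.asIdeal inferInstance
      (by exact_mod_cast hℓv)
  -- `e(w | v) = 1` since `v ∤ m`
  have hvm : ¬ Ideal.span {((m : ℕ) : 𝓞 K)} ≤ v.asIdeal := by
    intro hle
    have hmv : ((m : ℤ) : 𝓞 K) ∈ v.asIdeal := by
      have := (Ideal.span_singleton_le_iff_mem _).mp hle
      simpa using this
    exact hℓm (by exact_mod_cast (intCast_mem_asIdeal_iff_of_natCast_mem hℓ v hℓv (m : ℤ)).mp hmv)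
  haveI hunrw : Algebra.IsUnramifiedAt (𝓞 K) w.asIdeal :=
    isUnramifiedIn_ringClassField hK ι hm hvm w.asIdeal w.isPrime hwv
  -- hence `e(w | ℓ) = 1`
  haveI : Algebra.IsUnramifiedAt ℤ w.asIdeal :=
    Algebra.IsUnramifiedAt.comp (R := ℤ) (A := 𝓞 K) v.asIdeal w.asIdeal
  have he : w.asIdeal.ramificationIdx ℤ = 1 := Ideal.ramificationIdx_eq_one_of_isUnramifiedAt
  -- `d = r²` is a square in `L`, hence in `L_w`: contradiction with `ord_w(d) = 1`
  have hsq : IsSquare (algebraMap L (w.adicCompletion L) (d : L)) := by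
    refine ⟨algebraMap L (w.adicCompletion L) ⟨r, hrL⟩, ?_⟩
    rw [← map_mul, ← sq]
    congr 1
    apply Subtype.ext
    simp only [SubmonoidClass.mk_pow]
    push_cast
    exact hr.symm
  exact not_isSquare_adicCompletion_intCast_of_dvd_of_not_sq_dvd w hℓ hℓw he hℓd hℓ2d hsq

/-! ### Discharge of the two named facts -/

/-- **The named fact `RingClassField.genusRadical_mem_and_not_mem` HOLDS** (Cohn 1985,
(2.2.22)–Thm. 2.2.23; Cox 2013 §9.A): (i) `√d ∈ K[f]` for `d ≡ 1 (mod 4)` square-free and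
`|d| ∣ f` (`sqrt_intCast_mem_ringClassField`, square-freeness not even needed); (ii) `√d ∉ K[m]`
for a prime `ℓ ∣ d`, `ℓ ∤ m`, `ℓ ∤ d_K` (`sqrt_intCast_not_mem_ringClassField`, `ℓ ∥ d` by
square-freeness). Discharges the genus-field input of the cell `bsd-uniform`'s U2 head
`Summit.BirchSwinnertonDyer.Uniform.U2.bsdp_two_of_genusTheory`.
[cite: Cohn1985, (2.2.22)–Thm. 2.2.23] [cite: Cox2013, §9.A Thm. 9.2 and §6.A Thm. 6.1] -/
theorem RingClassField.genusRadical_mem_and_not_mem_holds :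
    RingClassField.genusRadical_mem_and_not_mem := by
  intro K _ _ hK ι d hd4 hsqf
  refine ⟨fun f hf hdf r hr => sqrt_intCast_mem_ringClassField hK ι hd4 hf hdf r hr,
    fun m ℓ hm hℓ hℓd hℓm hℓD r hr => ?_⟩
  have hℓ2d : ¬ (ℓ : ℤ) ^ 2 ∣ d := fun h2 => by
    have hu : IsUnit (ℓ : ℤ) := hsqf (ℓ : ℤ) (by rw [← sq]; exact h2)
    rw [Int.isUnit_iff_natAbs_eq, Int.natAbs_natCast] at hu
    exact hℓ.one_lt.ne' hu
  exact sqrt_intCast_not_mem_ringClassField hK ι hm hℓ hℓd hℓ2d hℓm hℓD r hr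

/-- **The named fact `Cox2013_sqrt_pStar_mem_ringClassField` HOLDS** (Cox 2013, Thm. 9.18 with
Cor. 8.7 / §9.A / Thm. 6.1): for `K` imaginary quadratic, `p` an odd prime and
`p* = (−1)^{(p−1)/2} p ≡ 1 (mod 4)`, every complex square root of `p*` lies in `K[p]`
(`sqrt_intCast_mem_ringClassField` with `d = p*`, `f = p`; the printed hypothesis `p ∤ d_K` is
not used). Discharges the genus datum of work item `wi-73261`
(`genusDatum_of_sqrt_pStar_mem`). [cite: Cox2013, Thm. 9.18 (with Cor. 8.7, §9.A, Thm. 6.1, Thm. 11.1)] -/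
theorem Cox2013_sqrt_pStar_mem_ringClassField_holds : Cox2013_sqrt_pStar_mem_ringClassField := by
  intro K _ _ hK ι p hp hp2 _ θ hθ
  have hpodd : p % 2 = 1 := Nat.odd_iff.mp (hp.odd_of_ne_two hp2)
  -- `d = p* = (−1)^{(p−1)/2} p ≡ 1 (mod 4)`, `|d| = p`
  set d : ℤ := (-1) ^ (p / 2) * (p : ℤ) with hddef
  have hd4 : d % 4 = 1 := by
    rcases Nat.odd_mod_four_iff.mp hpodd with h1 | h3
    · have heven : Even (p / 2) := ⟨p / 4, by omega⟩
      rw [hddef, heven.neg_one_pow, one_mul]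
      omega
    · have hodd : Odd (p / 2) := ⟨p / 4, by omega⟩
      rw [hddef, hodd.neg_one_pow, neg_one_mul]
      omega
  have hdabs : d.natAbs = p := by
    rw [hddef, Int.natAbs_mul, Int.natAbs_pow, Int.natAbs_neg, Int.natAbs_one, one_pow, one_mul,
      Int.natAbs_natCast]
  have hθ' : θ ^ 2 = (d : ℂ) := by rw [hθ, hddef]; push_cast; ring
  exact sqrt_intCast_mem_ringClassField hK ι hd4 hp.ne_zero (hdabs ▸ dvd_rfl) θ hθ'

end Literature.NumberTheory.EllipticCurves

end
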